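import Literature.AlgebraicGeometry.HodgeTheory.WeilClassesFieldLefschetzGroup
import Literature.AlgebraicGeometry.HodgeTheory.WeilClassesFieldProductsOrthogonal
import HarnessLib

/-!
# `W_F(A₁ × A₂)` decomposable ⟹ the Lefschetz groups of the factors fix `W_F(A₁)`, `W_F(A₂)`: the factors' Weil classes
# are Hodge, and decomposable where Milne's Cor. 4.5 holds (Moonen–Zarhin 1998, §2 display «⟹», via the Lefschetz group)

Layer `Literature/AlgebraicGeometry/HodgeTheory`, theorem-only junction of the seat's `WeilClassesFieldProductsOrthogonal`
(Moonen–Zarhin §2 for two Hom-orthogonal factors: the line of `W_F(A₁ × A₂) ⊗ ℂ` above a root `ρ` is spanned by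
`pr₁^* ω₁ ∪ pr₂^* ω₂`, and the direction «⟸» of the display), `WeilClassesFieldLefschetzGroup` / `WeilClassesFieldFLinear`
(Moonen–Zarhin's Lemma (2): an automorphism pair fixing `W_F` is `F`-linear of determinant one) and the tree's Milne
1999 layer (`S(A)(ℂ) = Milne1999.unitaryCentralizerGroup A h`; `s ⊕ t ∈ S(A₁ × A₂)(ℂ)` for Hom-orthogonal factors,
Prop. 1.5; Thm. 4.4 «any `γ ∈ G(A)` will fix all divisor classes»; the `S(A)(ℂ)`-invariants are Hodge classes; Cor. 4.5
packages).  Everything is proved; no definition, no named fact.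

PRINTED STATEMENT.  B. J. J. Moonen – Yu. G. Zarhin, *Weil classes on abelian varieties*, J. reine angew. Math. 496
(1998) 83–92 = arXiv:alg-geom/9612017 (held text `paper:arxiv-alg-geom_9612017`), §2 (chunk p0002, lines 21–31): «We
conclude from this that, if `W_F(X)` consists of Hodge classes, then: `W_F(X)` consists of decomposable Hodge classes
⟺ each of the spaces `W_F(Yᵢ^{mᵢ})` consists of decomposable Hodge classes», for `X = Y₁^{m₁} × ⋯ × Y_k^{m_k}` with
`Yᵢ` simple, mutually non-isogenous, `F` acting diagonally (lines 1–13), `W_F(X) = W_F(Y₁^{m₁}) ⊗_F ⋯ ⊗_F W_F(Y_k^{m_k})`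
inside the Künneth component.

RENDERING AND ROUTE.  Binary case `k = 2`, «simple, non-isogenous» read as HOM-ORTHOGONALITY (`Hom(A₁, A₂) = 0 =
Hom(A₂, A₁)`), under which every `Ψ ∈ End(A₁ × A₂)` is diagonal with corners `corner₁Ψ ∈ End(A₁)`, `corner₂Ψ ∈ End(A₂)`
and `P(Ψ) = 0` descends to the corners (`WeilClassesFieldProductsOrthogonal`).  The direction «⟸» is the tree's
`weilClassesField_prod_le_divisorClassesSpan_of_orthogonal`.  For «⟹» Moonen–Zarhin's «matter of linear algebra» uses the
splitting `NS(Y₁ × Y₂) ⊗ ℚ = NS(Y₁) ⊗ ℚ ⊕ NS(Y₂) ⊗ ℚ` of Hom-orthogonal factors, which the tree has only at torus level;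
this file reads «⟹» through the Lefschetz group instead (Moonen–Zarhin's §1 mechanism; Milne §3–4): if `W_F(A₁ × A₂) ⊗ ℂ
⊆ Dᵐ(A₁ × A₂) ⊗ ℂ` then for every `s ∈ S(A₁)(ℂ)` the element `s ⊕ 1 ∈ S(A₁ × A₂)(ℂ)` fixes `Dᵐ ⊗ ℂ` (Milne Thm. 4.4),
hence fixes `pr₁^* a ∪ pr₂^* ω₂ ∈ W_F(A₁ × A₂) ⊗ ℂ` for `a` on a line of `W_F(A₁) ⊗ ℂ` and `ω₂ ≠ 0` generating the matching
line of `W_F(A₂) ⊗ ℂ`; but `⋀(s ⊕ 1)(pr₁^* a ∪ pr₂^* ω₂) = pr₁^*(⋀s a) ∪ pr₂^* ω₂`, and `pr₁^*(·) ∪ pr₂^* ω₂` is injective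
(Künneth), so `⋀s a = a`: THE LEFSCHETZ GROUP OF EACH FACTOR FIXES ITS WEIL CLASSES.  Consequences: `S(Aᵢ)(ℂ) ⊂ Sl_F`
(Lemma (2)); `W_F(Aᵢ) ⊗ ℂ ⊆ B ⊗ ℂ` (the `S`-invariants are Hodge classes) — «each `W_F(Yᵢ^{mᵢ})` consists of Hodge
classes», with balanced multiplicities; and `W_F(Aᵢ) ⊗ ℂ ⊆ D ⊗ ℂ` — «decomposable» — as soon as the `S(Aᵢ)(ℂ)`-invariants
of `H^{2mᵢ}(Aᵢ)` are known to be in `D^{mᵢ} ⊗ ℂ` (Milne's Cor. 4.5 for `Aᵢ`, a tree theorem on the loci `End(Aᵢ)`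
commutative, `Aᵢ` simple of CM type, `B(Aᵢ) = D(Aᵢ)`; taken here as the tree's package hypothesis or through the
instances `IsDivisorGenerated Aᵢ`, `End(Aᵢ)` commutative).  (With `s = -1` and `r₁` odd, §1 says `W_F(A₁ × A₂) ⊗ ℂ ⊄ Dᵐ ⊗
ℂ` — the Example of §2, filed as `WeilClassesFieldProductsExceptional`; not restated here.)

WHAT IS PROVED.  `A₁`, `A₂` positive-dimensional complex abelian varieties with `∀ f : A₁ ⟶ A₂, f = 0`,
`∀ g : A₂ ⟶ A₁, g = 0`; `Ψ ∈ End(A₁ × A₂)`; `P ∈ ℤ[T]` monic, irreducible over `ℚ`, of degree `e`, `P(Ψ) = 0`;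
`e · r₁ = 2 dim A₁`, `e · r₂ = 2 dim A₂` (each statement carries the one(s) its proof uses), `r₁ + r₂ = 2m`; HYPOTHESIS
`hW : W_F(A₁ × A₂, Ψ) ⊗ ℂ ≤ Dᵐ(A₁ × A₂) ⊗ ℂ`.
* §1 **`forall_exteriorPullback_eq_of_mem_weilClassesField_fst_of_prod_le_divisorClassesSpan`** — for every `h₁ ∈ B¹(A₁) ⊗ ℂ`
  with `h₁^{dim A₁} ≠ 0` and `Q_{h₁}` non-degenerate and every `s ∈ S(A₁)(ℂ) = unitaryCentralizerGroup A₁ h₁`: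
  `⋀^{r₁}s a = a` for all `a ∈ W_F(A₁, corner₁Ψ) ⊗ ℂ`; `…_snd_…` — the same for `A₂`.
* §2 `detOnEigenspace_eq_one_fst_of_prod_le_divisorClassesSpan` — `det(s | V_ρ(corner₁Ψ)) = 1` at every complex root
  («`S ⊂ Sl_F`», Lemma (2)).
* §3 (`r₁ = 2m₁`, resp. `r₂ = 2m₂`) **`weilClassesField_fst_le_hodgeClassSpan_of_prod_le_divisorClassesSpan`** · `…_snd_…` —
  `W_F(Aᵢ, cornerᵢΨ) ⊗ ℂ ≤ B^{mᵢ}(Aᵢ) ⊗ ℂ`; `forall_eigenMultiplicity_eq_fst_of_prod_le_divisorClassesSpan` — balanced.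
* §4 **`weilClassesField_fst_le_divisorClassesSpan_of_prod_le_divisorClassesSpan_of_exists`** · `…_snd_…` — `W_F(Aᵢ) ⊗ ℂ ≤
  D^{mᵢ}(Aᵢ) ⊗ ℂ` granted Milne's Cor. 4.5 package for `Aᵢ`; instances `…_fst_…_of_isDivisorGenerated`,
  `…_fst_…_of_forall_comp_comm`.
* §5 THE DISPLAY: **`weilClassesField_prod_le_divisorClassesSpan_iff_of_exists`** (packages on both factors) and
  `weilClassesField_prod_le_divisorClassesSpan_iff_of_isDivisorGenerated` (`B = D` on both factors):
  `W_F(A₁ × A₂, Ψ) ⊗ ℂ ≤ D^{m₁+m₂} ⊗ ℂ ⟺ W_F(A₁, corner₁Ψ) ⊗ ℂ ≤ D^{m₁} ⊗ ℂ ∧ W_F(A₂, corner₂Ψ) ⊗ ℂ ≤ D^{m₂} ⊗ ℂ`.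
* §6 THE EXAMPLE BEYOND ODD RANKS (no hypothesis `hW`): `forall_eigenMultiplicity_eq_snd_of_prod_le_divisorClassesSpan`;
  **`weilClassesField_prod_inf_divisorClassesSpan_eq_bot_of_eigenMultiplicity_ne_fst`** · `…_snd` — if `cornerᵢΨ` is
  UNBALANCED at some root (`W_F(Aᵢ)` not Hodge) then `W_F(A₁ × A₂, Ψ) ⊗ ℂ ⊓ Dᵐ ⊗ ℂ = ⊥` («therefore all non-zero elements
  of `W_F(X)` are exceptional», by §3 and all-or-nothing);
  `exists_isRationalClass_isOfHodgeType_not_mem_divisorClassesSpan_prod_of_eigenMultiplicity_ne_fst` — if moreover `Ψ` is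
  balanced, an exceptional rational Hodge class on `A₁ × A₂` and `¬ IsDivisorGenerated (A₁ × A₂)`.

Honesty clause: conditional statements under the hypothesis «`W_F(A₁ × A₂)` decomposable»; §4–§5 are relative to
Milne's Cor. 4.5 for the factor (package hypothesis or the named loci) — Cor. 4.5 / Thm. 3.2 in general is NOT claimed;
no Weil class is proved algebraic, Hodge or decomposable outright.
No `sorry`; axioms `propext`, `Classical.choice`, `Quot.sound`.

## References
* [MoonenZarhin1998WeilClasses] B. J. J. Moonen, Yu. G. Zarhin, *Weil classes on abelian varieties*, J. reine angew.
  Math. 496 (1998) 83–92 = arXiv:alg-geom/9612017, §2 first paragraph and display (chunk p0002, lines 1–31), §1 Lemma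
  (2) and `G_div(X)`.
* [Milne1999LefschetzClasses] J. S. Milne, *Lefschetz classes on abelian varieties*, Duke Math. J. 96 (1999) 639–675, §1
  p. 643–644 (`S(A)`, Prop. 1.5), Lemma 3.1, Thm. 3.2, Prop. 3.4, Thm. 4.4 and Cor. 4.5 (p. 659).
* [vanGeemen1994HodgeAV] B. van Geemen, *An introduction to the Hodge conjecture for abelian varieties*, LNM 1594 (1994),
  2.4–2.5, 6.12.
* [HatcherAT2002] A. Hatcher, *Algebraic Topology* (2002), §3.2 Prop. 3.10, Thm. 3.16 (Künneth).
-/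

noncomputable section

open CategoryTheory Polynomial Module

namespace Literature.AlgebraicGeometry.HodgeTheory

open Literature.AlgebraicGeometry.Motives
open Literature.AlgebraicGeometry.VanGeemen1994 (hodgeClassSpan pullbackOne detOnEigenspace)
open Literature.AlgebraicGeometry.Milne1999 (unitaryCentralizerGroup prodBlockDiagEquiv prodPolarizationClass
  exteriorPullback_eq_self_of_mem_divisorClassesSpan_of_nondegenerate prodBlockDiagEquiv_mem_unitaryCentralizerGroup
  exteriorPullback_prodBlockDiagEquiv_cross exists_polarizationClass prodPolarizationClass_mem_hodgeClassSpan
  eq_zero_of_forall_polarizationPairingOne_prod_eq_zero exteriorPullback_id mem_hodgeClassSpan_of_forall_exteriorPullback_eq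
  mem_divisorClassesSpan_of_forall_exteriorPullback_eq_of_forall_comp_comm)
open Literature.AlgebraicGeometry.Milne1999.CMTypeProducts (cornerFst cornerSnd)
open Literature.AlgebraicTopology.SingularHomology
open Literature.Barriers.HodgeConjecture (divisorClassesSpan)
open Literature.Geometry.Kaehler (lefschetzPow)

section HodgeTheory

variable {A₁ A₂ : AbelianVariety ℂ} {Ψ : A₁.prod A₂ ⟶ A₁.prod A₂} {P : Polynomial ℤ} {e r₁ r₂ m m₁ m₂ : ℕ}
  {h₁ : complexBetti A₁.X 2} {h₂ : complexBetti A₂.X 2}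
  {s : complexBetti A₁.X 1 ≃ₗ[ℂ] complexBetti A₁.X 1} {t : complexBetti A₂.X 1 ≃ₗ[ℂ] complexBetti A₂.X 1}

/-- `0 < e` for `P` irreducible over `ℚ` of degree `e`. [folklore] -/
private theorem natDegree_pos_of_irreducible_map' (hPe : P.natDegree = e)
    (hPirr : Irreducible (P.map (Int.castRingHom ℚ))) : 0 < e := by
  rw [← hPe, ← natDegree_map_eq_of_injective (RingHom.injective_int (Int.castRingHom ℚ)) P]
  exact natDegree_pos_iff_degree_pos.2 (degree_pos_of_irreducible hPirr)

/-! ### §1 `W_F(A₁ × A₂)` decomposable ⟹ `S(A₁)(ℂ)` fixes `W_F(A₁) ⊗ ℂ` and `S(A₂)(ℂ)` fixes `W_F(A₂) ⊗ ℂ` -/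

section Fixed

/-- **`W_F(A₁ × A₂) ⊗ ℂ ⊆ Dᵐ ⊗ ℂ` ⟹ THE LEFSCHETZ GROUP OF `A₁` FIXES `W_F(A₁) ⊗ ℂ`.**  For Hom-orthogonal
positive-dimensional `A₁`, `A₂`, `P(Ψ) = 0` (`P` monic irreducible of degree `e`, `e · r₂ = 2 dim A₂`, `r₁ + r₂ = 2m`;
no hypothesis on `r₁` is needed), a class `h₁ ∈ B¹(A₁) ⊗ ℂ` with `h₁^{dim A₁} ≠ 0` and `Q_{h₁}` non-degenerate, and `s ∈ S(A₁)(ℂ)`: if every Weil class of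
`(A₁ × A₂, Ψ)` is a polynomial in divisor classes, then `⋀^{r₁}s a = a` for every `a ∈ W_F(A₁, corner₁Ψ) ⊗ ℂ`.  Proof:
`s ⊕ 1 ∈ S(A₁ × A₂)(ℂ)` (Milne Prop. 1.5) fixes `Dᵐ ⊗ ℂ` (Thm. 4.4), so fixes `pr₁^* a ∪ pr₂^* ω₂` (`a` on the line above
`ρ`, `ω₂ ≠ 0` on the line of `A₂` above `ρ` — a Weil class of the product, Moonen–Zarhin §2); by the Künneth step this is
`pr₁^*(⋀s a) ∪ pr₂^* ω₂`, and `pr₁^*(·) ∪ pr₂^* ω₂` is injective. [cite: MoonenZarhin1998WeilClasses, §2 (chunk p0002,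
lines 1–31)] [cite: Milne1999LefschetzClasses, §1 p. 643, Prop. 1.5, Thm. 4.4 (p. 659)] [cite: HatcherAT2002, §3.2 Thm. 3.16] -/
theorem forall_exteriorPullback_eq_of_mem_weilClassesField_fst_of_prod_le_divisorClassesSpan
    (hAB : ∀ f : A₁ ⟶ A₂, f = 0) (hBA : ∀ g : A₂ ⟶ A₁, g = 0) (hA₁0 : 0 < A₁.dim) (hA₂0 : 0 < A₂.dim)
    (hPm : P.Monic) (hPe : P.natDegree = e) (hPirr : Irreducible (P.map (Int.castRingHom ℚ)))
    (hΨ : Polynomial.eval₂ (Int.castRingHom (CategoryTheory.End (A₁.prod A₂)))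
      (Ψ : CategoryTheory.End (A₁.prod A₂)) P = 0)
    (her₂ : e * r₂ = 2 * A₂.dim) (hk : r₁ + r₂ = 2 * m)
    (hW : weilClassesField (A₁.prod A₂) Ψ P (2 * m) ≤ divisorClassesSpan (A₁.prod A₂).X (A₁.prod A₂).dim m)
    (hh₁ : h₁ ∈ hodgeClassSpan A₁.dim A₁.X 1) (h₁top : lefschetzPow h₁ (A₁.dim - 1) 2 h₁ ≠ 0)
    (hnd₁ : ∀ x : complexBetti A₁.X 1, (∀ y, polarizationPairingOne A₁.X h₁ (A₁.dim - 1) x y = 0) → x = 0)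
    (hs : s ∈ unitaryCentralizerGroup A₁ h₁) :
    ∀ a ∈ weilClassesField A₁ (cornerFst A₁ A₂ Ψ) P r₁,
      exteriorPullback (AbelianVariety.hasExteriorCohomologyH1_complexPoints A₁)
        (s : complexBetti A₁.X 1 →ₗ[ℂ] complexBetti A₁.X 1) r₁ a = a := by
  have he : 0 < e := natDegree_pos_of_irreducible_map' hPe hPirr
  have hX₁ : IsSmoothProjective A₁.dim A₁.X := AbelianVariety.isSmoothProjective_holds (A := A₁)
  have hX₂ : IsSmoothProjective A₂.dim A₂.X := AbelianVariety.isSmoothProjective_holds (A := A₂)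
  have hr₂ : r₂ ≤ 2 * A₂.dim := by
    rw [← her₂]
    exact Nat.le_mul_of_pos_left r₂ he
  have hΨ₁ := comp_fst_eq_fst_comp_cornerFst_of_orthogonal hAB hBA Ψ
  have hΨ₂ := comp_snd_eq_snd_comp_cornerSnd_of_orthogonal hAB hBA Ψ
  have hφ₂ := eval₂_cornerSnd_eq_zero_of_orthogonal hAB hBA hΨ
  -- a polarization class on `A₂`, the product class, and `s ⊕ 1 ∈ S(A₁ × A₂)(ℂ)`
  obtain ⟨h₂, -, -, hh₂, h₂top, hnd₂⟩ := exists_polarizationClass A₂ hA₂0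
  have hu : prodBlockDiagEquiv s (1 : complexBetti A₂.X 1 ≃ₗ[ℂ] complexBetti A₂.X 1) ∈
      unitaryCentralizerGroup (A₁.prod A₂) (prodPolarizationClass A₁ A₂ h₁ h₂) :=
    prodBlockDiagEquiv_mem_unitaryCentralizerGroup hAB hBA h₁top h₂top hs (Subgroup.one_mem _)
  have hh := prodPolarizationClass_mem_hodgeClassSpan h₁ h₂ hh₁ hh₂
  have hnd := eq_zero_of_forall_polarizationPairingOne_prod_eq_zero h₁ h₂ hA₁0 hA₂0 h₁top h₂top hnd₁ hnd₂
  -- it suffices to treat the classes on each line `⋀^{r₁} V_ρ(corner₁Ψ)`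
  have key : weilClassesField A₁ (cornerFst A₁ A₂ Ψ) P r₁ ≤
      LinearMap.eqLocus (exteriorPullback (AbelianVariety.hasExteriorCohomologyH1_complexPoints A₁)
        (s : complexBetti A₁.X 1 →ₗ[ℂ] complexBetti A₁.X 1) r₁) LinearMap.id := by
    refine iSup₂_le fun ρ hρ a ha => ?_
    rw [LinearMap.mem_eqLocus, LinearMap.id_apply]
    -- a generator `ω₂` of the line of `A₂` above `ρ`
    obtain ⟨ω₂, hω₂, hω₂0, -, -⟩ := exists_generator_pullbackEigenclasses_of_root hPm hPe hPirr hφ₂ her₂ hρ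
    -- `pr₁^* a ∪ pr₂^* ω₂ ∈ W_F(A₁ × A₂) ⊗ ℂ ⊆ Dᵐ ⊗ ℂ` is fixed by `⋀(s ⊕ 1)`
    have hgW : cupProduct hk (complexBetti.map (AbelianVariety.fst A₁ A₂).hom.hom.hom r₁ a)
        (complexBetti.map (AbelianVariety.snd A₁ A₂).hom.hom.hom r₂ ω₂) ∈
          weilClassesField (A₁.prod A₂) Ψ P (2 * m) :=
      pullbackEigenclasses_le_weilClassesField hρ
        (cupProduct_map_fst_map_snd_mem_pullbackEigenclasses_pow hΨ₁ hΨ₂ hk ha hω₂)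
    have hfix := exteriorPullback_eq_self_of_mem_divisorClassesSpan_of_nondegenerate hh hnd hu m (hW hgW)
    rw [show ((prodBlockDiagEquiv s (1 : complexBetti A₂.X 1 ≃ₗ[ℂ] complexBetti A₂.X 1) :
          complexBetti (A₁.prod A₂).X 1 ≃ₗ[ℂ] complexBetti (A₁.prod A₂).X 1) :
          complexBetti (A₁.prod A₂).X 1 →ₗ[ℂ] complexBetti (A₁.prod A₂).X 1) =
        (prodBlockDiagEquiv s (1 : complexBetti A₂.X 1 ≃ₗ[ℂ] complexBetti A₂.X 1)).toLinearMap from rfl,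
      exteriorPullback_prodBlockDiagEquiv_cross,
      show (1 : complexBetti A₂.X 1 ≃ₗ[ℂ] complexBetti A₂.X 1).toLinearMap = LinearMap.id from rfl,
      exteriorPullback_id, LinearMap.id_apply] at hfix
    -- `pr₁^*(⋀s a - a) ∪ pr₂^* ω₂ = 0` with `ω₂ ≠ 0` forces `⋀s a = a`
    by_contra hne
    refine cupProduct_map_fst_map_snd_ne_zero_of_add_eq hX₁ hX₂ hk hr₂ (sub_ne_zero.2 hne) hω₂0 ?_
    rw [map_sub, LinearMap.map_sub₂, sub_eq_zero]
    exact hfix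
  intro a ha
  have h := key ha
  rw [LinearMap.mem_eqLocus, LinearMap.id_apply] at h
  exact h

/-- **`W_F(A₁ × A₂) ⊗ ℂ ⊆ Dᵐ ⊗ ℂ` ⟹ THE LEFSCHETZ GROUP OF `A₂` FIXES `W_F(A₂) ⊗ ℂ`** (the symmetric statement, with
`1 ⊕ t ∈ S(A₁ × A₂)(ℂ)` and a generator of the line of `A₁`). [cite: MoonenZarhin1998WeilClasses, §2 (chunk p0002,
lines 1–31)] [cite: Milne1999LefschetzClasses, §1 p. 643, Prop. 1.5, Thm. 4.4 (p. 659)] [cite: HatcherAT2002, §3.2 Thm. 3.16] -/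
theorem forall_exteriorPullback_eq_of_mem_weilClassesField_snd_of_prod_le_divisorClassesSpan
    (hAB : ∀ f : A₁ ⟶ A₂, f = 0) (hBA : ∀ g : A₂ ⟶ A₁, g = 0) (hA₁0 : 0 < A₁.dim) (hA₂0 : 0 < A₂.dim)
    (hPm : P.Monic) (hPe : P.natDegree = e) (hPirr : Irreducible (P.map (Int.castRingHom ℚ)))
    (hΨ : Polynomial.eval₂ (Int.castRingHom (CategoryTheory.End (A₁.prod A₂)))
      (Ψ : CategoryTheory.End (A₁.prod A₂)) P = 0)
    (her₁ : e * r₁ = 2 * A₁.dim) (her₂ : e * r₂ = 2 * A₂.dim) (hk : r₁ + r₂ = 2 * m)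
    (hW : weilClassesField (A₁.prod A₂) Ψ P (2 * m) ≤ divisorClassesSpan (A₁.prod A₂).X (A₁.prod A₂).dim m)
    (hh₂ : h₂ ∈ hodgeClassSpan A₂.dim A₂.X 1) (h₂top : lefschetzPow h₂ (A₂.dim - 1) 2 h₂ ≠ 0)
    (hnd₂ : ∀ x : complexBetti A₂.X 1, (∀ y, polarizationPairingOne A₂.X h₂ (A₂.dim - 1) x y = 0) → x = 0)
    (ht : t ∈ unitaryCentralizerGroup A₂ h₂) :
    ∀ b ∈ weilClassesField A₂ (cornerSnd A₁ A₂ Ψ) P r₂,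
      exteriorPullback (AbelianVariety.hasExteriorCohomologyH1_complexPoints A₂)
        (t : complexBetti A₂.X 1 →ₗ[ℂ] complexBetti A₂.X 1) r₂ b = b := by
  have he : 0 < e := natDegree_pos_of_irreducible_map' hPe hPirr
  have hX₁ : IsSmoothProjective A₁.dim A₁.X := AbelianVariety.isSmoothProjective_holds (A := A₁)
  have hX₂ : IsSmoothProjective A₂.dim A₂.X := AbelianVariety.isSmoothProjective_holds (A := A₂)
  have hr₂ : r₂ ≤ 2 * A₂.dim := by
    rw [← her₂]
    exact Nat.le_mul_of_pos_left r₂ he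
  have hΨ₁ := comp_fst_eq_fst_comp_cornerFst_of_orthogonal hAB hBA Ψ
  have hΨ₂ := comp_snd_eq_snd_comp_cornerSnd_of_orthogonal hAB hBA Ψ
  have hφ₁ := eval₂_cornerFst_eq_zero_of_orthogonal hAB hBA hΨ
  -- a polarization class on `A₁`, the product class, and `1 ⊕ t ∈ S(A₁ × A₂)(ℂ)`
  obtain ⟨h₁, -, -, hh₁, h₁top, hnd₁⟩ := exists_polarizationClass A₁ hA₁0
  have hu : prodBlockDiagEquiv (1 : complexBetti A₁.X 1 ≃ₗ[ℂ] complexBetti A₁.X 1) t ∈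
      unitaryCentralizerGroup (A₁.prod A₂) (prodPolarizationClass A₁ A₂ h₁ h₂) :=
    prodBlockDiagEquiv_mem_unitaryCentralizerGroup hAB hBA h₁top h₂top (Subgroup.one_mem _) ht
  have hh := prodPolarizationClass_mem_hodgeClassSpan h₁ h₂ hh₁ hh₂
  have hnd := eq_zero_of_forall_polarizationPairingOne_prod_eq_zero h₁ h₂ hA₁0 hA₂0 h₁top h₂top hnd₁ hnd₂
  have key : weilClassesField A₂ (cornerSnd A₁ A₂ Ψ) P r₂ ≤
      LinearMap.eqLocus (exteriorPullback (AbelianVariety.hasExteriorCohomologyH1_complexPoints A₂)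
        (t : complexBetti A₂.X 1 →ₗ[ℂ] complexBetti A₂.X 1) r₂) LinearMap.id := by
    refine iSup₂_le fun ρ hρ b hb => ?_
    rw [LinearMap.mem_eqLocus, LinearMap.id_apply]
    -- a generator `ω₁` of the line of `A₁` above `ρ`
    obtain ⟨ω₁, hω₁, hω₁0, -, -⟩ := exists_generator_pullbackEigenclasses_of_root hPm hPe hPirr hφ₁ her₁ hρ
    have hgW : cupProduct hk (complexBetti.map (AbelianVariety.fst A₁ A₂).hom.hom.hom r₁ ω₁)
        (complexBetti.map (AbelianVariety.snd A₁ A₂).hom.hom.hom r₂ b) ∈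
          weilClassesField (A₁.prod A₂) Ψ P (2 * m) :=
      pullbackEigenclasses_le_weilClassesField hρ
        (cupProduct_map_fst_map_snd_mem_pullbackEigenclasses_pow hΨ₁ hΨ₂ hk hω₁ hb)
    have hfix := exteriorPullback_eq_self_of_mem_divisorClassesSpan_of_nondegenerate hh hnd hu m (hW hgW)
    rw [show ((prodBlockDiagEquiv (1 : complexBetti A₁.X 1 ≃ₗ[ℂ] complexBetti A₁.X 1) t :
          complexBetti (A₁.prod A₂).X 1 ≃ₗ[ℂ] complexBetti (A₁.prod A₂).X 1) :
          complexBetti (A₁.prod A₂).X 1 →ₗ[ℂ] complexBetti (A₁.prod A₂).X 1) =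
        (prodBlockDiagEquiv (1 : complexBetti A₁.X 1 ≃ₗ[ℂ] complexBetti A₁.X 1) t).toLinearMap from rfl,
      exteriorPullback_prodBlockDiagEquiv_cross,
      show (1 : complexBetti A₁.X 1 ≃ₗ[ℂ] complexBetti A₁.X 1).toLinearMap = LinearMap.id from rfl,
      exteriorPullback_id, LinearMap.id_apply] at hfix
    -- `pr₁^* ω₁ ∪ pr₂^*(⋀t b - b) = 0` with `ω₁ ≠ 0` forces `⋀t b = b`
    by_contra hne
    refine cupProduct_map_fst_map_snd_ne_zero_of_add_eq hX₁ hX₂ hk hr₂ hω₁0 (sub_ne_zero.2 hne) ?_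
    rw [map_sub, map_sub, sub_eq_zero]
    exact hfix
  intro b hb
  have h := key hb
  rw [LinearMap.mem_eqLocus, LinearMap.id_apply] at h
  exact h

end Fixed

/-! ### §2 Hence `S(A₁)(ℂ) ⊂ Sl_F(V(A₁))(ℂ)` (Moonen–Zarhin's Lemma (2)) -/

section Determinant

/-- **`W_F(A₁ × A₂)` decomposable ⟹ `det(s | V_ρ(corner₁Ψ)) = 1` for every `s ∈ S(A₁)(ℂ)` and every complex root `ρ`
of `P`** («`G_div ⊆ Sl_F`»): `⋀^{r₁}s` fixes `W_F(A₁) ⊗ ℂ` (§1), and an automorphism pair fixing `W_F` has determinant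
one on each eigenspace (Moonen–Zarhin Lemma (2), the tree's `detOnEigenspace_eq_one_of_forall_apply_eq_of_mem_weilClassesField`).
[cite: MoonenZarhin1998WeilClasses, §1 Lemma (2) and §2 (chunk p0002)] [cite: Milne1999LefschetzClasses, Thm. 4.4] -/
theorem detOnEigenspace_eq_one_fst_of_prod_le_divisorClassesSpan
    (hAB : ∀ f : A₁ ⟶ A₂, f = 0) (hBA : ∀ g : A₂ ⟶ A₁, g = 0) (hA₁0 : 0 < A₁.dim) (hA₂0 : 0 < A₂.dim)
    (hPm : P.Monic) (hPe : P.natDegree = e) (hPirr : Irreducible (P.map (Int.castRingHom ℚ)))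
    (hΨ : Polynomial.eval₂ (Int.castRingHom (CategoryTheory.End (A₁.prod A₂)))
      (Ψ : CategoryTheory.End (A₁.prod A₂)) P = 0)
    (her₁ : e * r₁ = 2 * A₁.dim) (her₂ : e * r₂ = 2 * A₂.dim) (hk : r₁ + r₂ = 2 * m)
    (hW : weilClassesField (A₁.prod A₂) Ψ P (2 * m) ≤ divisorClassesSpan (A₁.prod A₂).X (A₁.prod A₂).dim m)
    (hh₁ : h₁ ∈ hodgeClassSpan A₁.dim A₁.X 1) (h₁top : lefschetzPow h₁ (A₁.dim - 1) 2 h₁ ≠ 0)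
    (hnd₁ : ∀ x : complexBetti A₁.X 1, (∀ y, polarizationPairingOne A₁.X h₁ (A₁.dim - 1) x y = 0) → x = 0)
    (hs : s ∈ unitaryCentralizerGroup A₁ h₁) {ρ : ℂ} (hρ : Polynomial.eval₂ (Int.castRingHom ℂ) ρ P = 0) :
    detOnEigenspace s (pullbackOne A₁ (cornerFst A₁ A₂ Ψ)) (hs.1 (cornerFst A₁ A₂ Ψ)) ρ = 1 :=
  detOnEigenspace_eq_one_of_forall_apply_eq_of_mem_weilClassesField hPm hPe hPirr
    (eval₂_cornerFst_eq_zero_of_orthogonal hAB hBA hΨ) her₁ (exteriorPullback_cupPowOne_abelianVariety s r₁)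
    (forall_exteriorPullback_eq_of_mem_weilClassesField_fst_of_prod_le_divisorClassesSpan hAB hBA hA₁0 hA₂0 hPm hPe
      hPirr hΨ her₂ hk hW hh₁ h₁top hnd₁ hs) hρ

end Determinant

/-! ### §3 Hence `W_F(A₁) ⊗ ℂ`, `W_F(A₂) ⊗ ℂ` consist of Hodge classes (`rᵢ = 2mᵢ`) -/

section Hodge

/-- **`W_F(A₁ × A₂)` decomposable ⟹ `W_F(A₁, corner₁Ψ) ⊗ ℂ ⊆ B^{m₁}(A₁) ⊗ ℂ`** (`e · 2m₁ = 2 dim A₁`): the classes of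
`W_F(A₁) ⊗ ℂ` are fixed by `S(A₁)(ℂ)` for a polarization class (§1 with `Milne1999.exists_polarizationClass`), and
`S(A)(ℂ)`-invariant classes are Hodge classes (the tree's `Milne1999.mem_hodgeClassSpan_of_forall_exteriorPullback_eq`,
Milne p. 660 `Hg ⊆ L`). «each of the spaces `W_F(Yᵢ^{mᵢ})` consists of … Hodge classes».
[cite: MoonenZarhin1998WeilClasses, §2 display (chunk p0002, lines 21–31)] [cite: Milne1999LefschetzClasses, Thm. 4.4, p. 660] -/
theorem weilClassesField_fst_le_hodgeClassSpan_of_prod_le_divisorClassesSpan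
    (hAB : ∀ f : A₁ ⟶ A₂, f = 0) (hBA : ∀ g : A₂ ⟶ A₁, g = 0) (hA₁0 : 0 < A₁.dim) (hA₂0 : 0 < A₂.dim)
    (hPm : P.Monic) (hPe : P.natDegree = e) (hPirr : Irreducible (P.map (Int.castRingHom ℚ)))
    (hΨ : Polynomial.eval₂ (Int.castRingHom (CategoryTheory.End (A₁.prod A₂)))
      (Ψ : CategoryTheory.End (A₁.prod A₂)) P = 0)
    (her₂ : e * r₂ = 2 * A₂.dim) (hk : 2 * m₁ + r₂ = 2 * m)
    (hW : weilClassesField (A₁.prod A₂) Ψ P (2 * m) ≤ divisorClassesSpan (A₁.prod A₂).X (A₁.prod A₂).dim m) :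
    weilClassesField A₁ (cornerFst A₁ A₂ Ψ) P (2 * m₁) ≤ hodgeClassSpan A₁.dim A₁.X m₁ := by
  obtain ⟨h₁, -, -, hh₁, h₁top, hnd₁⟩ := exists_polarizationClass A₁ hA₁0
  intro c hc
  exact mem_hodgeClassSpan_of_forall_exteriorPullback_eq hh₁ fun s hs =>
    forall_exteriorPullback_eq_of_mem_weilClassesField_fst_of_prod_le_divisorClassesSpan hAB hBA hA₁0 hA₂0 hPm hPe hPirr
      hΨ her₂ hk hW hh₁ h₁top hnd₁ hs c hc

/-- **`W_F(A₁ × A₂)` decomposable ⟹ `W_F(A₂, corner₂Ψ) ⊗ ℂ ⊆ B^{m₂}(A₂) ⊗ ℂ`** (`e · 2m₂ = 2 dim A₂`).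
[cite: MoonenZarhin1998WeilClasses, §2 display (chunk p0002, lines 21–31)] [cite: Milne1999LefschetzClasses, Thm. 4.4, p. 660] -/
theorem weilClassesField_snd_le_hodgeClassSpan_of_prod_le_divisorClassesSpan
    (hAB : ∀ f : A₁ ⟶ A₂, f = 0) (hBA : ∀ g : A₂ ⟶ A₁, g = 0) (hA₁0 : 0 < A₁.dim) (hA₂0 : 0 < A₂.dim)
    (hPm : P.Monic) (hPe : P.natDegree = e) (hPirr : Irreducible (P.map (Int.castRingHom ℚ)))
    (hΨ : Polynomial.eval₂ (Int.castRingHom (CategoryTheory.End (A₁.prod A₂)))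
      (Ψ : CategoryTheory.End (A₁.prod A₂)) P = 0)
    (her₁ : e * r₁ = 2 * A₁.dim) (her₂ : e * (2 * m₂) = 2 * A₂.dim) (hk : r₁ + 2 * m₂ = 2 * m)
    (hW : weilClassesField (A₁.prod A₂) Ψ P (2 * m) ≤ divisorClassesSpan (A₁.prod A₂).X (A₁.prod A₂).dim m) :
    weilClassesField A₂ (cornerSnd A₁ A₂ Ψ) P (2 * m₂) ≤ hodgeClassSpan A₂.dim A₂.X m₂ := by
  obtain ⟨h₂, -, -, hh₂, h₂top, hnd₂⟩ := exists_polarizationClass A₂ hA₂0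
  intro c hc
  exact mem_hodgeClassSpan_of_forall_exteriorPullback_eq hh₂ fun t ht =>
    forall_exteriorPullback_eq_of_mem_weilClassesField_snd_of_prod_le_divisorClassesSpan hAB hBA hA₁0 hA₂0 hPm hPe hPirr
      hΨ her₁ her₂ hk hW hh₂ h₂top hnd₂ ht c hc

/-- … hence **the multiplicities of `corner₁Ψ` are balanced**: `n_ρ = n_ρ̄` on `H^{1,0}(A₁)` at every complex root of `P`
(the tree's `Deligne1982.weilClassesField_le_hodgeClassSpan_iff_forall_eigenMultiplicity_eq`).
[cite: MoonenZarhin1998WeilClasses, §1 Criterion (4) and §2 display (chunk p0002)] -/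
theorem forall_eigenMultiplicity_eq_fst_of_prod_le_divisorClassesSpan
    (hAB : ∀ f : A₁ ⟶ A₂, f = 0) (hBA : ∀ g : A₂ ⟶ A₁, g = 0) (hA₁0 : 0 < A₁.dim) (hA₂0 : 0 < A₂.dim)
    (hPm : P.Monic) (hPe : P.natDegree = e) (hPirr : Irreducible (P.map (Int.castRingHom ℚ)))
    (hΨ : Polynomial.eval₂ (Int.castRingHom (CategoryTheory.End (A₁.prod A₂)))
      (Ψ : CategoryTheory.End (A₁.prod A₂)) P = 0)
    (her₁ : e * (2 * m₁) = 2 * A₁.dim) (her₂ : e * r₂ = 2 * A₂.dim) (hk : 2 * m₁ + r₂ = 2 * m)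
    (hW : weilClassesField (A₁.prod A₂) Ψ P (2 * m) ≤ divisorClassesSpan (A₁.prod A₂).X (A₁.prod A₂).dim m)
    {ρ : ℂ} (hρ : Polynomial.eval₂ (Int.castRingHom ℂ) ρ P = 0) :
    eigenMultiplicity A₁ (cornerFst A₁ A₂ Ψ) ρ = eigenMultiplicity A₁ (cornerFst A₁ A₂ Ψ) (starRingEnd ℂ ρ) :=
  (Deligne1982.weilClassesField_le_hodgeClassSpan_iff_forall_eigenMultiplicity_eq hPm hPe hPirr
    (eval₂_cornerFst_eq_zero_of_orthogonal hAB hBA hΨ) her₁).1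
    (weilClassesField_fst_le_hodgeClassSpan_of_prod_le_divisorClassesSpan hAB hBA hA₁0 hA₂0 hPm hPe hPirr hΨ her₂
      hk hW) ρ hρ

end Hodge

/-! ### §4 … and decomposable where Milne's Cor. 4.5 holds for the factor -/

section Decomposable

/-- **`W_F(A₁ × A₂)` decomposable ⟹ `W_F(A₁, corner₁Ψ)` decomposable, granted Milne's Cor. 4.5 for `A₁`** in the tree's
package shape (SOME class `D ∈ B¹(A₁) ⊗ ℂ` with `D^{dim A₁} ≠ 0`, `Q_D` non-degenerate, whose `S(A₁)(ℂ)`-invariants in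
every even degree are Lefschetz — a tree theorem for `End(A₁)` commutative, `A₁` simple of CM type, `B(A₁) = D(A₁)`,
`Milne1999/SpecialLefschetzGroupInvariantsFiniteProducts`): `W_F(A₁, corner₁Ψ) ⊗ ℂ ≤ D^{m₁}(A₁) ⊗ ℂ`.  «`W_F(X)` consists
of decomposable Hodge classes ⟹ each of the spaces `W_F(Yᵢ^{mᵢ})` consists of decomposable Hodge classes».
[cite: MoonenZarhin1998WeilClasses, §2 display (chunk p0002, lines 21–31)] [cite: Milne1999LefschetzClasses, Thm. 3.2,
Cor. 4.5 (p. 659)] -/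
theorem weilClassesField_fst_le_divisorClassesSpan_of_prod_le_divisorClassesSpan_of_exists
    (hAB : ∀ f : A₁ ⟶ A₂, f = 0) (hBA : ∀ g : A₂ ⟶ A₁, g = 0) (hA₁0 : 0 < A₁.dim) (hA₂0 : 0 < A₂.dim)
    (hPm : P.Monic) (hPe : P.natDegree = e) (hPirr : Irreducible (P.map (Int.castRingHom ℚ)))
    (hΨ : Polynomial.eval₂ (Int.castRingHom (CategoryTheory.End (A₁.prod A₂)))
      (Ψ : CategoryTheory.End (A₁.prod A₂)) P = 0)
    (her₂ : e * r₂ = 2 * A₂.dim) (hk : 2 * m₁ + r₂ = 2 * m)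
    (hrec : ∃ D : complexBetti A₁.X 2, D ∈ hodgeClassSpan A₁.dim A₁.X 1 ∧ lefschetzPow D (A₁.dim - 1) 2 D ≠ 0 ∧
      (∀ z : complexBetti A₁.X 1, (∀ y, polarizationPairingOne A₁.X D (A₁.dim - 1) z y = 0) → z = 0) ∧
      ∀ (a : ℕ) (y : complexBetti A₁.X (2 * a)), (∀ u ∈ unitaryCentralizerGroup A₁ D,
        exteriorPullback (AbelianVariety.hasExteriorCohomologyH1_complexPoints A₁)
          (u : complexBetti A₁.X 1 →ₗ[ℂ] complexBetti A₁.X 1) (2 * a) y = y) → y ∈ divisorClassesSpan A₁.X A₁.dim a)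
    (hW : weilClassesField (A₁.prod A₂) Ψ P (2 * m) ≤ divisorClassesSpan (A₁.prod A₂).X (A₁.prod A₂).dim m) :
    weilClassesField A₁ (cornerFst A₁ A₂ Ψ) P (2 * m₁) ≤ divisorClassesSpan A₁.X A₁.dim m₁ := by
  obtain ⟨D, hD, hDtop, hDnd, rec⟩ := hrec
  intro c hc
  exact rec m₁ c fun s hs =>
    forall_exteriorPullback_eq_of_mem_weilClassesField_fst_of_prod_le_divisorClassesSpan hAB hBA hA₁0 hA₂0 hPm hPe hPirr
      hΨ her₂ hk hW hD hDtop hDnd hs c hc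

/-- **`W_F(A₁ × A₂)` decomposable ⟹ `W_F(A₂, corner₂Ψ)` decomposable, granted Milne's Cor. 4.5 package for `A₂`.**
[cite: MoonenZarhin1998WeilClasses, §2 display (chunk p0002, lines 21–31)] [cite: Milne1999LefschetzClasses, Thm. 3.2,
Cor. 4.5 (p. 659)] -/
theorem weilClassesField_snd_le_divisorClassesSpan_of_prod_le_divisorClassesSpan_of_exists
    (hAB : ∀ f : A₁ ⟶ A₂, f = 0) (hBA : ∀ g : A₂ ⟶ A₁, g = 0) (hA₁0 : 0 < A₁.dim) (hA₂0 : 0 < A₂.dim)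
    (hPm : P.Monic) (hPe : P.natDegree = e) (hPirr : Irreducible (P.map (Int.castRingHom ℚ)))
    (hΨ : Polynomial.eval₂ (Int.castRingHom (CategoryTheory.End (A₁.prod A₂)))
      (Ψ : CategoryTheory.End (A₁.prod A₂)) P = 0)
    (her₁ : e * r₁ = 2 * A₁.dim) (her₂ : e * (2 * m₂) = 2 * A₂.dim) (hk : r₁ + 2 * m₂ = 2 * m)
    (hrec : ∃ D : complexBetti A₂.X 2, D ∈ hodgeClassSpan A₂.dim A₂.X 1 ∧ lefschetzPow D (A₂.dim - 1) 2 D ≠ 0 ∧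
      (∀ z : complexBetti A₂.X 1, (∀ y, polarizationPairingOne A₂.X D (A₂.dim - 1) z y = 0) → z = 0) ∧
      ∀ (a : ℕ) (y : complexBetti A₂.X (2 * a)), (∀ u ∈ unitaryCentralizerGroup A₂ D,
        exteriorPullback (AbelianVariety.hasExteriorCohomologyH1_complexPoints A₂)
          (u : complexBetti A₂.X 1 →ₗ[ℂ] complexBetti A₂.X 1) (2 * a) y = y) → y ∈ divisorClassesSpan A₂.X A₂.dim a)
    (hW : weilClassesField (A₁.prod A₂) Ψ P (2 * m) ≤ divisorClassesSpan (A₁.prod A₂).X (A₁.prod A₂).dim m) :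
    weilClassesField A₂ (cornerSnd A₁ A₂ Ψ) P (2 * m₂) ≤ divisorClassesSpan A₂.X A₂.dim m₂ := by
  obtain ⟨D, hD, hDtop, hDnd, rec⟩ := hrec
  intro c hc
  exact rec m₂ c fun t ht =>
    forall_exteriorPullback_eq_of_mem_weilClassesField_snd_of_prod_le_divisorClassesSpan hAB hBA hA₁0 hA₂0 hPm hPe hPirr
      hΨ her₁ her₂ hk hW hD hDtop hDnd ht c hc

/-- **Instance `B(A₁) = D(A₁)`** (`IsDivisorGenerated A₁`: every rational Hodge class of type `(p, p)` on `A₁` lies in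
`Dᵖ ⊗ ℂ`): `W_F(A₁ × A₂)` decomposable ⟹ `W_F(A₁, corner₁Ψ) ⊗ ℂ ≤ D^{m₁}(A₁) ⊗ ℂ` (through §3: `W_F(A₁) ⊗ ℂ` lies in
the span of the rational Hodge classes). [cite: MoonenZarhin1998WeilClasses, §2 display (chunk p0002)]
[cite: vanGeemen1994HodgeAV, 2.4–2.5] -/
theorem weilClassesField_fst_le_divisorClassesSpan_of_prod_le_divisorClassesSpan_of_isDivisorGenerated
    (hAB : ∀ f : A₁ ⟶ A₂, f = 0) (hBA : ∀ g : A₂ ⟶ A₁, g = 0) (hA₁0 : 0 < A₁.dim) (hA₂0 : 0 < A₂.dim)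
    (hPm : P.Monic) (hPe : P.natDegree = e) (hPirr : Irreducible (P.map (Int.castRingHom ℚ)))
    (hΨ : Polynomial.eval₂ (Int.castRingHom (CategoryTheory.End (A₁.prod A₂)))
      (Ψ : CategoryTheory.End (A₁.prod A₂)) P = 0)
    (her₂ : e * r₂ = 2 * A₂.dim) (hk : 2 * m₁ + r₂ = 2 * m)
    (hBD : IsDivisorGenerated A₁)
    (hW : weilClassesField (A₁.prod A₂) Ψ P (2 * m) ≤ divisorClassesSpan (A₁.prod A₂).X (A₁.prod A₂).dim m) :
    weilClassesField A₁ (cornerFst A₁ A₂ Ψ) P (2 * m₁) ≤ divisorClassesSpan A₁.X A₁.dim m₁ := by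
  refine le_trans (weilClassesField_fst_le_hodgeClassSpan_of_prod_le_divisorClassesSpan hAB hBA hA₁0 hA₂0 hPm hPe hPirr
    hΨ her₂ hk hW) ?_
  rw [Submodule.span_le]
  rintro c ⟨hcQ, hcH⟩
  exact hBD m₁ c hcQ hcH

/-- **Instance `End(A₁)` commutative** (Milne's Cor. 4.5 for `A₁` is the tree theorem
`Milne1999.mem_divisorClassesSpan_of_forall_exteriorPullback_eq_of_forall_comp_comm`): `W_F(A₁ × A₂)` decomposable ⟹
`W_F(A₁, corner₁Ψ) ⊗ ℂ ≤ D^{m₁}(A₁) ⊗ ℂ`. [cite: MoonenZarhin1998WeilClasses, §2 display (chunk p0002)]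
[cite: Milne1999LefschetzClasses, Thm. 3.2 (commutative case), Cor. 4.5] -/
theorem weilClassesField_fst_le_divisorClassesSpan_of_prod_le_divisorClassesSpan_of_forall_comp_comm
    (hAB : ∀ f : A₁ ⟶ A₂, f = 0) (hBA : ∀ g : A₂ ⟶ A₁, g = 0) (hA₁0 : 0 < A₁.dim) (hA₂0 : 0 < A₂.dim)
    (hPm : P.Monic) (hPe : P.natDegree = e) (hPirr : Irreducible (P.map (Int.castRingHom ℚ)))
    (hΨ : Polynomial.eval₂ (Int.castRingHom (CategoryTheory.End (A₁.prod A₂)))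
      (Ψ : CategoryTheory.End (A₁.prod A₂)) P = 0)
    (her₂ : e * r₂ = 2 * A₂.dim) (hk : 2 * m₁ + r₂ = 2 * m)
    (hcomm : ∀ φ ψ : A₁ ⟶ A₁, φ ≫ ψ = ψ ≫ φ)
    (hW : weilClassesField (A₁.prod A₂) Ψ P (2 * m) ≤ divisorClassesSpan (A₁.prod A₂).X (A₁.prod A₂).dim m) :
    weilClassesField A₁ (cornerFst A₁ A₂ Ψ) P (2 * m₁) ≤ divisorClassesSpan A₁.X A₁.dim m₁ := by
  obtain ⟨h₁, hQ, hK, hh₁, h₁top, hnd₁⟩ := exists_polarizationClass A₁ hA₁0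
  intro c hc
  exact mem_divisorClassesSpan_of_forall_exteriorPullback_eq_of_forall_comp_comm hcomm hQ hK m₁ c fun s hs =>
    forall_exteriorPullback_eq_of_mem_weilClassesField_fst_of_prod_le_divisorClassesSpan hAB hBA hA₁0 hA₂0 hPm hPe hPirr
      hΨ her₂ hk hW hh₁ h₁top hnd₁ hs c hc

end Decomposable

/-! ### §5 The display as an `iff` -/

section Display

/-- **MOONEN–ZARHIN'S DISPLAY FOR TWO HOM-ORTHOGONAL FACTORS, granted Milne's Cor. 4.5 packages on both factors:
`W_F(A₁ × A₂, Ψ) ⊗ ℂ ≤ D^{m₁+m₂} ⊗ ℂ ⟺ W_F(A₁, corner₁Ψ) ⊗ ℂ ≤ D^{m₁} ⊗ ℂ ∧ W_F(A₂, corner₂Ψ) ⊗ ℂ ≤ D^{m₂} ⊗ ℂ`**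
(«⟸» is the tree's `weilClassesField_prod_le_divisorClassesSpan_of_orthogonal`; «⟹» is §4).
[cite: MoonenZarhin1998WeilClasses, §2 display (chunk p0002, lines 21–31)] [cite: Milne1999LefschetzClasses, Cor. 4.5] -/
theorem weilClassesField_prod_le_divisorClassesSpan_iff_of_exists
    (hAB : ∀ f : A₁ ⟶ A₂, f = 0) (hBA : ∀ g : A₂ ⟶ A₁, g = 0) (hA₁0 : 0 < A₁.dim) (hA₂0 : 0 < A₂.dim)
    (hPm : P.Monic) (hPe : P.natDegree = e) (hPirr : Irreducible (P.map (Int.castRingHom ℚ)))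
    (hΨ : Polynomial.eval₂ (Int.castRingHom (CategoryTheory.End (A₁.prod A₂)))
      (Ψ : CategoryTheory.End (A₁.prod A₂)) P = 0)
    (her₁ : e * (2 * m₁) = 2 * A₁.dim) (her₂ : e * (2 * m₂) = 2 * A₂.dim)
    (hrec₁ : ∃ D : complexBetti A₁.X 2, D ∈ hodgeClassSpan A₁.dim A₁.X 1 ∧ lefschetzPow D (A₁.dim - 1) 2 D ≠ 0 ∧
      (∀ z : complexBetti A₁.X 1, (∀ y, polarizationPairingOne A₁.X D (A₁.dim - 1) z y = 0) → z = 0) ∧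
      ∀ (a : ℕ) (y : complexBetti A₁.X (2 * a)), (∀ u ∈ unitaryCentralizerGroup A₁ D,
        exteriorPullback (AbelianVariety.hasExteriorCohomologyH1_complexPoints A₁)
          (u : complexBetti A₁.X 1 →ₗ[ℂ] complexBetti A₁.X 1) (2 * a) y = y) → y ∈ divisorClassesSpan A₁.X A₁.dim a)
    (hrec₂ : ∃ D : complexBetti A₂.X 2, D ∈ hodgeClassSpan A₂.dim A₂.X 1 ∧ lefschetzPow D (A₂.dim - 1) 2 D ≠ 0 ∧
      (∀ z : complexBetti A₂.X 1, (∀ y, polarizationPairingOne A₂.X D (A₂.dim - 1) z y = 0) → z = 0) ∧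
      ∀ (a : ℕ) (y : complexBetti A₂.X (2 * a)), (∀ u ∈ unitaryCentralizerGroup A₂ D,
        exteriorPullback (AbelianVariety.hasExteriorCohomologyH1_complexPoints A₂)
          (u : complexBetti A₂.X 1 →ₗ[ℂ] complexBetti A₂.X 1) (2 * a) y = y) → y ∈ divisorClassesSpan A₂.X A₂.dim a) :
    weilClassesField (A₁.prod A₂) Ψ P (2 * (m₁ + m₂)) ≤
        divisorClassesSpan (A₁.prod A₂).X (A₁.prod A₂).dim (m₁ + m₂) ↔
      weilClassesField A₁ (cornerFst A₁ A₂ Ψ) P (2 * m₁) ≤ divisorClassesSpan A₁.X A₁.dim m₁ ∧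
        weilClassesField A₂ (cornerSnd A₁ A₂ Ψ) P (2 * m₂) ≤ divisorClassesSpan A₂.X A₂.dim m₂ := by
  have hk : 2 * m₁ + 2 * m₂ = 2 * (m₁ + m₂) := by ring
  refine ⟨fun hW => ⟨?_, ?_⟩, fun hW => ?_⟩
  · exact weilClassesField_fst_le_divisorClassesSpan_of_prod_le_divisorClassesSpan_of_exists hAB hBA hA₁0 hA₂0 hPm hPe
      hPirr hΨ her₂ hk hrec₁ hW
  · exact weilClassesField_snd_le_divisorClassesSpan_of_prod_le_divisorClassesSpan_of_exists hAB hBA hA₁0 hA₂0 hPm hPe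
      hPirr hΨ her₁ her₂ hk hrec₂ hW
  · exact weilClassesField_prod_le_divisorClassesSpan_of_orthogonal hAB hBA hPm hPe hPirr hΨ her₁ her₂ hW.1 hW.2

/-- **THE DISPLAY ON THE `B = D` LOCUS** (`IsDivisorGenerated A₁`, `IsDivisorGenerated A₂` — e.g. factors of dimension
`≤ 3`, products of elliptic curves): `W_F(A₁ × A₂, Ψ) ⊗ ℂ ≤ D^{m₁+m₂} ⊗ ℂ ⟺ W_F(A₁, corner₁Ψ) ⊗ ℂ ≤ D^{m₁} ⊗ ℂ ∧
W_F(A₂, corner₂Ψ) ⊗ ℂ ≤ D^{m₂} ⊗ ℂ`. [cite: MoonenZarhin1998WeilClasses, §2 display (chunk p0002, lines 21–31)]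
[cite: vanGeemen1994HodgeAV, 2.4–2.5] -/
theorem weilClassesField_prod_le_divisorClassesSpan_iff_of_isDivisorGenerated
    (hAB : ∀ f : A₁ ⟶ A₂, f = 0) (hBA : ∀ g : A₂ ⟶ A₁, g = 0) (hA₁0 : 0 < A₁.dim) (hA₂0 : 0 < A₂.dim)
    (hPm : P.Monic) (hPe : P.natDegree = e) (hPirr : Irreducible (P.map (Int.castRingHom ℚ)))
    (hΨ : Polynomial.eval₂ (Int.castRingHom (CategoryTheory.End (A₁.prod A₂)))
      (Ψ : CategoryTheory.End (A₁.prod A₂)) P = 0)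
    (her₁ : e * (2 * m₁) = 2 * A₁.dim) (her₂ : e * (2 * m₂) = 2 * A₂.dim)
    (hBD₁ : IsDivisorGenerated A₁) (hBD₂ : IsDivisorGenerated A₂) :
    weilClassesField (A₁.prod A₂) Ψ P (2 * (m₁ + m₂)) ≤
        divisorClassesSpan (A₁.prod A₂).X (A₁.prod A₂).dim (m₁ + m₂) ↔
      weilClassesField A₁ (cornerFst A₁ A₂ Ψ) P (2 * m₁) ≤ divisorClassesSpan A₁.X A₁.dim m₁ ∧
        weilClassesField A₂ (cornerSnd A₁ A₂ Ψ) P (2 * m₂) ≤ divisorClassesSpan A₂.X A₂.dim m₂ := by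
  have hk : 2 * m₁ + 2 * m₂ = 2 * (m₁ + m₂) := by ring
  refine ⟨fun hW => ⟨?_, ?_⟩, fun hW => ?_⟩
  · exact weilClassesField_fst_le_divisorClassesSpan_of_prod_le_divisorClassesSpan_of_isDivisorGenerated hAB hBA hA₁0 hA₂0
      hPm hPe hPirr hΨ her₂ hk hBD₁ hW
  · -- the second factor through §3 and `B(A₂) = D(A₂)`
    refine le_trans (weilClassesField_snd_le_hodgeClassSpan_of_prod_le_divisorClassesSpan hAB hBA hA₁0 hA₂0 hPm hPe
      hPirr hΨ her₁ her₂ hk hW) ?_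
    rw [Submodule.span_le]
    rintro c ⟨hcQ, hcH⟩
    exact hBD₂ m₂ c hcQ hcH
  · exact weilClassesField_prod_le_divisorClassesSpan_of_orthogonal hAB hBA hPm hPe hPirr hΨ her₁ her₂ hW.1 hW.2

end Display

/-! ### §6 The Example beyond odd ranks: an unbalanced factor makes every Weil class of the product exceptional -/

section Unbalanced

/-- … and **the multiplicities of `corner₂Ψ` are balanced** when `W_F(A₁ × A₂)` is decomposable (`e · 2m₂ = 2 dim A₂`).
[cite: MoonenZarhin1998WeilClasses, §1 Criterion (4) and §2 display (chunk p0002)] -/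
theorem forall_eigenMultiplicity_eq_snd_of_prod_le_divisorClassesSpan
    (hAB : ∀ f : A₁ ⟶ A₂, f = 0) (hBA : ∀ g : A₂ ⟶ A₁, g = 0) (hA₁0 : 0 < A₁.dim) (hA₂0 : 0 < A₂.dim)
    (hPm : P.Monic) (hPe : P.natDegree = e) (hPirr : Irreducible (P.map (Int.castRingHom ℚ)))
    (hΨ : Polynomial.eval₂ (Int.castRingHom (CategoryTheory.End (A₁.prod A₂)))
      (Ψ : CategoryTheory.End (A₁.prod A₂)) P = 0)
    (her₁ : e * r₁ = 2 * A₁.dim) (her₂ : e * (2 * m₂) = 2 * A₂.dim) (hk : r₁ + 2 * m₂ = 2 * m)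
    (hW : weilClassesField (A₁.prod A₂) Ψ P (2 * m) ≤ divisorClassesSpan (A₁.prod A₂).X (A₁.prod A₂).dim m)
    {ρ : ℂ} (hρ : Polynomial.eval₂ (Int.castRingHom ℂ) ρ P = 0) :
    eigenMultiplicity A₂ (cornerSnd A₁ A₂ Ψ) ρ = eigenMultiplicity A₂ (cornerSnd A₁ A₂ Ψ) (starRingEnd ℂ ρ) :=
  (Deligne1982.weilClassesField_le_hodgeClassSpan_iff_forall_eigenMultiplicity_eq hPm hPe hPirr
    (eval₂_cornerSnd_eq_zero_of_orthogonal hAB hBA hΨ) her₂).1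
    (weilClassesField_snd_le_hodgeClassSpan_of_prod_le_divisorClassesSpan hAB hBA hA₁0 hA₂0 hPm hPe hPirr hΨ her₁ her₂
      hk hW) ρ hρ

/-- `e · 2m = 2 dim (A₁ × A₂)` from `e · rᵢ = 2 dim Aᵢ` and `r₁ + r₂ = 2m`. [folklore] -/
private theorem mul_two_mul_eq_two_mul_dim_prod' (her₁ : e * r₁ = 2 * A₁.dim) (her₂ : e * r₂ = 2 * A₂.dim)
    (hk : r₁ + r₂ = 2 * m) : e * (2 * m) = 2 * (A₁.prod A₂).dim := by
  rw [AbelianVariety.dim_prod, ← hk, mul_add, her₁, her₂, mul_add]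

/-- **`W_F(A₁, corner₁Ψ)` NOT HODGE ⟹ `W_F(A₁ × A₂, Ψ) ⊗ ℂ ⊓ Dᵐ ⊗ ℂ = ⊥`** (`e · 2m₁ = 2 dim A₁`): if the multiplicities
of `corner₁Ψ` are unbalanced at some complex root of `P` («non-zero elements of `W_F(Y₁)` are not Hodge classes»), then
NO non-zero Weil class of the product is a polynomial in divisor classes («therefore all non-zero elements of `W_F(X)` are
exceptional») — Moonen–Zarhin's inference of the Example, here for an even rank `r₁ = 2m₁`: `W_F(X)` decomposable would
force `W_F(Y₁)` Hodge (§3), and `W_F(X) ⊗ ℂ` either lies in `Dᵐ ⊗ ℂ` or meets it in `0` (all or nothing, the tree's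
`weilClassesField_inf_divisorClassesSpan_eq_bot_or_le`).  The odd-rank case is `WeilClassesFieldProductsExceptional`.
[cite: MoonenZarhin1998WeilClasses, §2 display and Example (chunk p0002, lines 21–38), §1 «all or nothing» (chunk p0001)] -/
theorem weilClassesField_prod_inf_divisorClassesSpan_eq_bot_of_eigenMultiplicity_ne_fst
    (hAB : ∀ f : A₁ ⟶ A₂, f = 0) (hBA : ∀ g : A₂ ⟶ A₁, g = 0) (hA₁0 : 0 < A₁.dim) (hA₂0 : 0 < A₂.dim)
    (hPm : P.Monic) (hPe : P.natDegree = e) (hPirr : Irreducible (P.map (Int.castRingHom ℚ)))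
    (hΨ : Polynomial.eval₂ (Int.castRingHom (CategoryTheory.End (A₁.prod A₂)))
      (Ψ : CategoryTheory.End (A₁.prod A₂)) P = 0)
    (her₁ : e * (2 * m₁) = 2 * A₁.dim) (her₂ : e * r₂ = 2 * A₂.dim) (hk : 2 * m₁ + r₂ = 2 * m)
    {ρ : ℂ} (hρ : Polynomial.eval₂ (Int.castRingHom ℂ) ρ P = 0)
    (hne : eigenMultiplicity A₁ (cornerFst A₁ A₂ Ψ) ρ ≠ eigenMultiplicity A₁ (cornerFst A₁ A₂ Ψ) (starRingEnd ℂ ρ)) :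
    weilClassesField (A₁.prod A₂) Ψ P (2 * m) ⊓ divisorClassesSpan (A₁.prod A₂).X (A₁.prod A₂).dim m = ⊥ := by
  have her := mul_two_mul_eq_two_mul_dim_prod' her₁ her₂ hk
  have hm : m ≠ 0 := by
    rintro rfl
    have hm₁ : m₁ = 0 := by omega
    rw [hm₁, mul_zero, mul_zero] at her₁
    omega
  rcases weilClassesField_inf_divisorClassesSpan_eq_bot_or_le hPe hPirr hΨ her hm with h | h
  · exact h
  · exact absurd (forall_eigenMultiplicity_eq_fst_of_prod_le_divisorClassesSpan hAB hBA hA₁0 hA₂0 hPm hPe hPirr hΨ her₁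
      her₂ hk h hρ) hne

/-- **`W_F(A₂, corner₂Ψ)` NOT HODGE ⟹ `W_F(A₁ × A₂, Ψ) ⊗ ℂ ⊓ Dᵐ ⊗ ℂ = ⊥`** (the symmetric statement, `e · 2m₂ = 2 dim A₂`).
[cite: MoonenZarhin1998WeilClasses, §2 display and Example (chunk p0002, lines 21–38), §1 «all or nothing» (chunk p0001)] -/
theorem weilClassesField_prod_inf_divisorClassesSpan_eq_bot_of_eigenMultiplicity_ne_snd
    (hAB : ∀ f : A₁ ⟶ A₂, f = 0) (hBA : ∀ g : A₂ ⟶ A₁, g = 0) (hA₁0 : 0 < A₁.dim) (hA₂0 : 0 < A₂.dim)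
    (hPm : P.Monic) (hPe : P.natDegree = e) (hPirr : Irreducible (P.map (Int.castRingHom ℚ)))
    (hΨ : Polynomial.eval₂ (Int.castRingHom (CategoryTheory.End (A₁.prod A₂)))
      (Ψ : CategoryTheory.End (A₁.prod A₂)) P = 0)
    (her₁ : e * r₁ = 2 * A₁.dim) (her₂ : e * (2 * m₂) = 2 * A₂.dim) (hk : r₁ + 2 * m₂ = 2 * m)
    {ρ : ℂ} (hρ : Polynomial.eval₂ (Int.castRingHom ℂ) ρ P = 0)
    (hne : eigenMultiplicity A₂ (cornerSnd A₁ A₂ Ψ) ρ ≠ eigenMultiplicity A₂ (cornerSnd A₁ A₂ Ψ) (starRingEnd ℂ ρ)) :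
    weilClassesField (A₁.prod A₂) Ψ P (2 * m) ⊓ divisorClassesSpan (A₁.prod A₂).X (A₁.prod A₂).dim m = ⊥ := by
  have her := mul_two_mul_eq_two_mul_dim_prod' her₁ her₂ hk
  have hm : m ≠ 0 := by
    rintro rfl
    have hm₂ : m₂ = 0 := by omega
    rw [hm₂, mul_zero, mul_zero] at her₂
    omega
  rcases weilClassesField_inf_divisorClassesSpan_eq_bot_or_le hPe hPirr hΨ her hm with h | h
  · exact h
  · exact absurd (forall_eigenMultiplicity_eq_snd_of_prod_le_divisorClassesSpan hAB hBA hA₁0 hA₂0 hPm hPe hPirr hΨ her₁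
      her₂ hk h hρ) hne

/-- **EXCEPTIONAL HODGE CLASSES ON `A₁ × A₂` FROM AN UNBALANCED FACTOR**: if `corner₁Ψ` is unbalanced at some root while
`Ψ` itself is balanced at every root («if `W_F(X)` consists of Hodge classes»), then `W_F(A₁ × A₂)` contains a non-zero
RATIONAL class of Hodge type `(m, m)` outside `Dᵐ ⊗ ℂ`, and `B^•(A₁ × A₂) ≠ D^•(A₁ × A₂)` (`¬ IsDivisorGenerated`).
[cite: MoonenZarhin1998WeilClasses, §2 Example (chunk p0002, lines 33–38)] [cite: vanGeemen1994HodgeAV, 2.4–2.5] -/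
theorem exists_isRationalClass_isOfHodgeType_not_mem_divisorClassesSpan_prod_of_eigenMultiplicity_ne_fst
    (hAB : ∀ f : A₁ ⟶ A₂, f = 0) (hBA : ∀ g : A₂ ⟶ A₁, g = 0) (hA₁0 : 0 < A₁.dim) (hA₂0 : 0 < A₂.dim)
    (hPm : P.Monic) (hPe : P.natDegree = e) (hPirr : Irreducible (P.map (Int.castRingHom ℚ)))
    (hΨ : Polynomial.eval₂ (Int.castRingHom (CategoryTheory.End (A₁.prod A₂)))
      (Ψ : CategoryTheory.End (A₁.prod A₂)) P = 0)
    (her₁ : e * (2 * m₁) = 2 * A₁.dim) (her₂ : e * r₂ = 2 * A₂.dim) (hk : 2 * m₁ + r₂ = 2 * m)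
    {ρ : ℂ} (hρ : Polynomial.eval₂ (Int.castRingHom ℂ) ρ P = 0)
    (hne : eigenMultiplicity A₁ (cornerFst A₁ A₂ Ψ) ρ ≠ eigenMultiplicity A₁ (cornerFst A₁ A₂ Ψ) (starRingEnd ℂ ρ))
    (hbal : ∀ ρ' : ℂ, Polynomial.eval₂ (Int.castRingHom ℂ) ρ' P = 0 →
      eigenMultiplicity (A₁.prod A₂) Ψ ρ' = eigenMultiplicity (A₁.prod A₂) Ψ (starRingEnd ℂ ρ')) :
    (∃ c ∈ weilClassesField (A₁.prod A₂) Ψ P (2 * m), IsRationalClass c ∧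
      IsOfHodgeType (A₁.prod A₂).dim (A₁.prod A₂).X (2 * m) m m c ∧ c ≠ 0 ∧
      c ∉ divisorClassesSpan (A₁.prod A₂).X (A₁.prod A₂).dim m) ∧ ¬ IsDivisorGenerated (A₁.prod A₂) := by
  have her := mul_two_mul_eq_two_mul_dim_prod' her₁ her₂ hk
  have hbot := weilClassesField_prod_inf_divisorClassesSpan_eq_bot_of_eigenMultiplicity_ne_fst hAB hBA hA₁0 hA₂0 hPm hPe
    hPirr hΨ her₁ her₂ hk hρ hne
  obtain ⟨c, hcW, hcQ, hc0⟩ := exists_isRationalClass_ne_zero_mem_weilClassesField hPm hPe hPirr hΨ her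
  have hcH := isOfHodgeType_of_mem_weilClassesField_of_balanced hPm hPe hPirr hΨ her hbal hcW
  rw [show 2 * m / 2 = m by omega] at hcH
  have hcD : c ∉ divisorClassesSpan (A₁.prod A₂).X (A₁.prod A₂).dim m := fun hcD => by
    have h0 : c ∈ weilClassesField (A₁.prod A₂) Ψ P (2 * m) ⊓
        divisorClassesSpan (A₁.prod A₂).X (A₁.prod A₂).dim m := ⟨hcW, hcD⟩
    rw [hbot, Submodule.mem_bot] at h0
    exact hc0 h0
  exact ⟨⟨c, hcW, hcQ, hcH, hc0, hcD⟩, fun hD => hcD (hD m c hcQ hcH)⟩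

end Unbalanced

end HodgeTheory

end Literature.AlgebraicGeometry.HodgeTheory

end
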